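import Mathlib
import Summits.NavierStokesRegularity.NavierStokesRegularity.Theorems.FilamentSkeletonRssSkeletonJ1RLiaSelfSplit

/-!
# Crux `SkeletonJ1R` (stmt-NavierStokesRegularity-23610) · line `streamline_kantorovich_R` · toward stub F2-d (`LiaDefectDerivBL`, v7), brick S1′ for B1′:
# THE EXACT SECOND-ORDER SPLIT OF THE SYMMETRIZED SELF-STRAND DERIVATIVE INTEGRAND (the `O(s)` terms cancel by antisymmetry of `×`)

Hand `leafhand-ns-filamentskeletonrs-1` (gen 0), `--supports stmt-NavierStokesRegularity-23610 --as helper`.  MODEL rung, NEGATIVE side of the ladder: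
elementary calculus of curves for a HYPOTHETICAL filament-type blow-up skeleton; nothing here is a claim about Navier–Stokes regularity; the stub and the crux
stay OPEN.

The symmetrized derivative integrand of the self strand (`…LiaSelfDerivSymm.selfStrand_derivKernel_symm`) is, with `w = Xτ − Xσ`, `P = X′τ`,
`D(σ) = (−3⟪w, P − X′σ⟫K₅(w))•X′σ×w + K₃(w)•[X′σ×(P − X′σ) + X″σ×w]` (`derivKernel_symm_combine`, pure algebra).  Its numerator is SECOND order in
`s = τ − σ` although each summand is first order: expanding about `σ`, `X′τ − X′σ = s•X″σ + A₁`, `Xτ − Xσ = s•X′σ + (s²/2)•X″σ + A₀`, the `O(s)` terms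
`s(X′σ×X″σ + X″σ×X′σ)` and `(s²/2)X″σ×X″σ` vanish, leaving
* `cross_symm_split` : `X′σ×(P − X′σ) + X″σ×w = X′σ×A₁ + X″σ×A₀` (exact, for arbitrary vectors);
with the segment-local third-order Taylor bounds for a `C²` curve whose curvature is `H`-Lipschitz about `σ` on `[[σ, τ]]`:
* `norm_derivIncrement_sub_model_le` : `‖A₁‖ = ‖X′τ − X′σ − (τ−σ)•X″σ‖ ≤ H(τ−σ)²`;
* `taylorThree_eq_integral`, `norm_taylorThree_le` : `A₀ = Xτ − Xσ − (τ−σ)•X′σ − ((τ−σ)²/2)•X″σ = ∫_σ^τ (X′p − X′σ − (p−σ)•X″σ) dp`, `‖A₀‖ ≤ H|τ−σ|³`;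
* `norm_symm_numerator_le` : `‖X′σ×(X′τ − X′σ) + X″σ×(Xτ − Xσ)‖ ≤ H(τ−σ)² + κ_σ·H|τ−σ|³` (`‖X′σ‖ = 1`, `‖X″σ‖ ≤ κ_σ`).
So on the logarithmic window `D(σ) ≈ K₃(s)·[X′σ×A₁ + X″σ×A₀] = O(H s²·K₃)`, whose integral is the `Λ_e(R)·X′×X‴` local-induction term of `Ȧ_j` — the S2′–S4′
bricks (window model, envelope zone, far zone) remain.
-/

set_option linter.dupNamespace false -- `NavierStokesRegularity.NavierStokesRegularity` path/namespace repetition is the tree convention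

noncomputable section

namespace Summit.NavierStokesRegularity.NavierStokesRegularity.Theorems.SkeletonJ1RLiaSelf

open Set Function Filter Real Topology MeasureTheory intervalIntegral
open Literature.Analysis.FluidPDE
open scoped InnerProductSpace BigOperators Interval

/-! ## §1 Algebra -/

/-- Combining the fixed-`σ` derivative kernel with `∂_σ f`: `G(w, a, P) + ∂_σ f = (−3⟪w, P − a⟫k₅)•a×w + k₃•(a×(P − a) + b×w)` (pure algebra;
`a = X′σ`, `b = X″σ`, `k₅, k₃` the kernel values). [folklore] -/
theorem derivKernel_symm_combine (w a b P : EuclideanSpace ℝ (Fin 3)) (k₅ k₃ : ℝ) :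
    ((-3 * ⟪w, P⟫_ℝ * k₅) • cross a w + k₃ • cross a P) +
        ((-3 * ⟪w, -a⟫_ℝ * k₅) • cross a w + k₃ • (cross a (-a) + cross b w)) =
      (-3 * ⟪w, P - a⟫_ℝ * k₅) • cross a w + k₃ • (cross a (P - a) + cross b w) := by
  have h1 : ⟪w, P - a⟫_ℝ = ⟪w, P⟫_ℝ + ⟪w, -a⟫_ℝ := by rw [inner_sub_right, inner_neg_right, sub_eq_add_neg]
  have h2 : cross a (P - a) = cross a P + cross a (-a) := by
    rw [← crossCLM_apply, ← crossCLM_apply, ← crossCLM_apply, map_sub, map_neg, sub_eq_add_neg]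
  rw [h1, h2]
  simp only [add_mul, mul_add, add_smul, smul_add]
  abel

/-- **The cancellation**: `T×(P − T) + N×W = T×(P − T − s•N) + N×(W − s•T − (s²/2)•N)` for all vectors (`T×N + N×T = 0`, `N×N = 0`). [folklore] -/
theorem cross_symm_split (T N P W : EuclideanSpace ℝ (Fin 3)) (s : ℝ) :
    cross T (P - T) + cross N W = cross T (P - T - s • N) + cross N (W - s • T - (s ^ 2 / 2) • N) := by
  ext i
  fin_cases i <;> simp [cross, crossProduct, smul_eq_mul] <;> ring

/-! ## §2 Third-order Taylor bounds about `σ` for a `C²` curve with Lipschitz curvature -/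

variable {X : ℝ → EuclideanSpace ℝ (Fin 3)}

/-- If `p ∈ [[σ, τ]]` then `|p − σ| ≤ |τ − σ|`. [folklore] -/
theorem abs_sub_left_le_of_mem_uIcc {σ τ p : ℝ} (hp : p ∈ uIcc σ τ) : |p - σ| ≤ |τ - σ| := by
  rcases mem_uIcc.1 hp with ⟨h1, h2⟩ | ⟨h1, h2⟩
  · rw [abs_of_nonneg (by linarith : (0:ℝ) ≤ p - σ), abs_of_nonneg (by linarith : (0:ℝ) ≤ τ - σ)]; linarith
  · rw [abs_of_nonpos (by linarith : p - σ ≤ 0), abs_of_nonpos (by linarith : τ - σ ≤ 0)]; linarith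

/-- `‖X′τ − X′σ − (τ−σ)•X″σ‖ ≤ H(τ−σ)²` when `‖X″q − X″σ‖ ≤ H|q − σ|` on `[[σ, τ]]`. [folklore] -/
theorem norm_derivIncrement_sub_model_le (hX : ContDiff ℝ 2 X) {τ σ H : ℝ} (hH0 : 0 ≤ H)
    (hH : ∀ q ∈ uIcc σ τ, ‖deriv (deriv X) q - deriv (deriv X) σ‖ ≤ H * |q - σ|) :
    ‖deriv X τ - deriv X σ - (τ - σ) • deriv (deriv X) σ‖ ≤ H * (τ - σ) ^ 2 := by
  have h := norm_deriv_sub_deriv_sub_smul_le hX (τ := σ) (σ := τ) hH0 hH left_mem_uIcc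
  calc ‖deriv X τ - deriv X σ - (τ - σ) • deriv (deriv X) σ‖ ≤ H * |τ - σ| * |τ - σ| := h
    _ = H * (τ - σ) ^ 2 := by rw [mul_assoc, abs_mul_abs_self, sq]

/-- `∫_σ^τ (p − σ) dp = (τ−σ)²/2`. [folklore] -/
theorem integral_sub_left (σ τ : ℝ) : ∫ p in σ..τ, (p - σ) = (τ - σ) ^ 2 / 2 := by
  rw [intervalIntegral.integral_sub intervalIntegrable_id (continuous_const.intervalIntegrable _ _),
    intervalIntegral.integral_const, integral_id]
  ring

/-- Third-order Taylor remainder about `σ` as an integral: `Xτ − Xσ − (τ−σ)•X′σ − ((τ−σ)²/2)•X″σ = ∫_σ^τ (X′p − X′σ − (p−σ)•X″σ) dp`. [folklore] -/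
theorem taylorThree_eq_integral (hX : ContDiff ℝ 2 X) (σ τ : ℝ) :
    X τ - X σ - (τ - σ) • deriv X σ - ((τ - σ) ^ 2 / 2) • deriv (deriv X) σ =
      ∫ p in σ..τ, (deriv X p - deriv X σ - (p - σ) • deriv (deriv X) σ) := by
  have hc : Continuous (deriv X) := hX.continuous_deriv (by norm_num)
  have I1 : IntervalIntegrable (fun p => deriv X p - deriv X σ) volume σ τ := (hc.sub continuous_const).intervalIntegrable _ _
  have I2 : IntervalIntegrable (fun p => (p - σ) • deriv (deriv X) σ) volume σ τ :=
    ((continuous_id.sub continuous_const).smul continuous_const).intervalIntegrable _ _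
  rw [intervalIntegral.integral_sub I1 I2, intervalIntegral.integral_smul_const, ← taylorTwo_eq_integral hX σ τ, integral_sub_left]

/-- **Third-order Taylor bound**: `‖Xτ − Xσ − (τ−σ)•X′σ − ((τ−σ)²/2)•X″σ‖ ≤ H|τ−σ|³` when `‖X″q − X″σ‖ ≤ H|q − σ|` on `[[σ, τ]]`. [folklore] -/
theorem norm_taylorThree_le (hX : ContDiff ℝ 2 X) {τ σ H : ℝ} (hH0 : 0 ≤ H)
    (hH : ∀ q ∈ uIcc σ τ, ‖deriv (deriv X) q - deriv (deriv X) σ‖ ≤ H * |q - σ|) :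
    ‖X τ - X σ - (τ - σ) • deriv X σ - ((τ - σ) ^ 2 / 2) • deriv (deriv X) σ‖ ≤ H * |τ - σ| ^ 3 := by
  rw [taylorThree_eq_integral hX σ τ]
  have hH1 : 0 ≤ H * |τ - σ| := by positivity
  have hb : ∀ p ∈ Ι σ τ, ‖deriv X p - deriv X σ - (p - σ) • deriv (deriv X) σ‖ ≤ H * |τ - σ| * |τ - σ| := by
    intro p hp
    have hp' : p ∈ uIcc σ τ := uIoc_subset_uIcc hp
    have hsub : uIcc σ p ⊆ uIcc σ τ := uIcc_subset_uIcc left_mem_uIcc hp'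
    have h := norm_deriv_sub_deriv_sub_smul_le hX (τ := σ) (σ := p) hH0 (fun q hq => hH q (hsub hq)) left_mem_uIcc
    refine h.trans ?_
    have hpσ : |p - σ| ≤ |τ - σ| := abs_sub_left_le_of_mem_uIcc hp'
    calc H * |p - σ| * |p - σ| ≤ H * |τ - σ| * |τ - σ| := by gcongr
      _ = H * |τ - σ| * |τ - σ| := rfl
  have h := intervalIntegral.norm_integral_le_of_norm_le_const hb
  calc ‖∫ p in σ..τ, (deriv X p - deriv X σ - (p - σ) • deriv (deriv X) σ)‖ ≤ H * |τ - σ| * |τ - σ| * |τ - σ| := h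
    _ = H * |τ - σ| ^ 3 := by ring

/-! ## §3 The symmetrized numerator is second order -/

/-- **`‖X′σ×(X′τ − X′σ) + X″σ×(Xτ − Xσ)‖ ≤ H(τ−σ)² + κ_σ H|τ−σ|³`** for a unit-speed `C²` curve with `‖X″σ‖ ≤ κ_σ` and curvature `H`-Lipschitz
about `σ` on `[[σ, τ]]`. [folklore] -/
theorem norm_symm_numerator_le (hX : ContDiff ℝ 2 X) (hunit : ∀ s, ‖deriv X s‖ = 1) {τ σ H κ : ℝ} (hH0 : 0 ≤ H)
    (hH : ∀ q ∈ uIcc σ τ, ‖deriv (deriv X) q - deriv (deriv X) σ‖ ≤ H * |q - σ|) (hκ : ‖deriv (deriv X) σ‖ ≤ κ) :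
    ‖cross (deriv X σ) (deriv X τ - deriv X σ) + cross (deriv (deriv X) σ) (X τ - X σ)‖ ≤
      H * (τ - σ) ^ 2 + κ * (H * |τ - σ| ^ 3) := by
  have hκ0 : 0 ≤ κ := (norm_nonneg _).trans hκ
  rw [cross_symm_split (deriv X σ) (deriv (deriv X) σ) (deriv X τ) (X τ - X σ) (τ - σ)]
  have hA1 := norm_derivIncrement_sub_model_le hX hH0 hH
  have hA0 := norm_taylorThree_le hX hH0 hH
  calc _ ≤ ‖cross (deriv X σ) (deriv X τ - deriv X σ - (τ - σ) • deriv (deriv X) σ)‖ +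
        ‖cross (deriv (deriv X) σ) (X τ - X σ - (τ - σ) • deriv X σ - ((τ - σ) ^ 2 / 2) • deriv (deriv X) σ)‖ := norm_add_le _ _
    _ ≤ ‖deriv X σ‖ * ‖deriv X τ - deriv X σ - (τ - σ) • deriv (deriv X) σ‖ +
        ‖deriv (deriv X) σ‖ * ‖X τ - X σ - (τ - σ) • deriv X σ - ((τ - σ) ^ 2 / 2) • deriv (deriv X) σ‖ :=
          add_le_add (norm_cross_le_norm_mul_norm _ _) (norm_cross_le_norm_mul_norm _ _)
    _ ≤ 1 * (H * (τ - σ) ^ 2) + κ * (H * |τ - σ| ^ 3) := by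
          rw [hunit σ]
          exact add_le_add (mul_le_mul_of_nonneg_left hA1 zero_le_one) (mul_le_mul hκ hA0 (norm_nonneg _) hκ0)
    _ = H * (τ - σ) ^ 2 + κ * (H * |τ - σ| ^ 3) := by rw [one_mul]

end Summit.NavierStokesRegularity.NavierStokesRegularity.Theorems.SkeletonJ1RLiaSelf

end
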